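import Mathlib.GroupTheory.SpecificGroups.Dihedral
import Literature.NumberTheory.EllipticCurves.BSDSelmerParityDokchitserTwistFormProofs
import Literature.NumberTheory.EllipticCurves.AnalyticRankOverNumberField
import HarnessLib

/-!
# Orders of vanishing forced by the Heegner hypothesis: `1` or `≥ 3` over `K`, `≥ n` over dihedral `F`

Topic `Literature/NumberTheory/EllipticCurves`. Two printed "central order forced by structure"
statements for an elliptic curve `E/ℚ` and an imaginary quadratic field `K` in which every prime
dividing the conductor `N_E` splits (Heegner hypothesis, tree predicate
`SatisfiesHeegnerHypothesis (W.conductorNorm ℤ) K` with `IsImaginaryQuadratic K`):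

* **Gross–Zagier 1986, V.(1.2) Corollary** (p. 309): "Let `f ∈ S₂(Γ₀(N))` be any newform and `χ`
  any character of `Gal(H/K)`. Then either all conjugates `L(f^σ, χ^σ, s)` (`σ ∈ Gal(ℚ̄/ℚ)`) have
  a simple zero at `s = 1` or else all have a zero of order `≥ 3`. Indeed, each `L(f^σ, χ^σ, s)`
  has an odd order zero at `s = 1` by the functional equation …". For the rational newform `f` of
  an elliptic curve `E/ℚ` and the trivial character `χ = 1` there are no non-trivial conjugates and
  `L(f, 1, s) = L(E/K, s) = L(E, s) L(E^{(d_K)}, s)`, so the corollary reads: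
  `ord_{s=1} L(E/K, s) = 1` or `≥ 3`. PROVED here (`analyticRankEK_eq_one_or_three_le_of_odd`)
  from the odd order of vanishing, itself a theorem of the tree modulo the Modularity Theorem
  (`odd_analyticRankEK_of_satisfiesHeegnerHypothesis_of_exists_isNewformOf`,
  `BSDSelmerParityDokchitserTwistFormProofs`); hence
  `analyticRankEK_eq_one_or_three_le_of_exists_isNewformOf` rests on `exists_isNewformOf` alone,
  and `analyticRankOver_eq_one_or_three_le_of_exists_isNewformOf` restates it for
  `r_an(E/K) = W.analyticRankOver K` through the compatibility fact
  `analyticRankOver_eq_analyticRankEK`.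
* **Kellock–Dokchitser 2023, Prop. 3.54 (ii)** (§3.16 "Heegner hypothesis"): "Let `E/ℚ` be an
  elliptic curve and let `K` be a quadratic extension of `ℚ` that satisfies the Heegner hypothesis.
  Let `F` be a `C_n`-extension of `K` so that `Gal(F/ℚ) = D_{2n}`, the dihedral group with `2n`
  elements. Assume that `(N_E, Δ_F) = 1`. Then … The order of vanishing of the `L`-function of `E/F`
  satisfies `ord_{s=1} L(E/F, s) ≥ n`." Printed proof: `L(E/F, s) = ∏_χ L(E/K, χ, s)` over the `n`
  characters `χ` of `Gal(F/K)` (inductivity), each factor self-dual with root number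
  `w(E/K, χ) = -1` under the Heegner hypothesis, hence of odd order at `s = 1`. TYPED here as the
  named fact `KellockDokchitser2023_prop_3_54_ii` (D-0014) in the tree's carriers
  (`WeierstrassCurve.analyticRankOver`, Mathlib `DihedralGroup`, `IsGalois`, `IsCyclic`,
  `NumberField.discr`); not proved — the tree has no twisted `L`-series `L(E/K, χ, s)` to run the
  printed factorisation on (its analytic skeleton, "`n` factors of sign `-1` force order `≥ n`", is
  the proved `Literature.NumberTheory.LFunctions.CentralOrder.sum_le_analyticOrderAt_finset_prod_pow_of_sign`).
  Part (i) (odd order of each `L(E/K, χ, s)`) is not typed for the same reason; part (iii) is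
  conditional on the parity conjecture for twists and is not typed.

## References

* [GrossZagierInvent1986] B. H. Gross, D. B. Zagier, *Heegner points and derivatives of
  `L`-series*, Invent. Math. 84 (1986), V.(1.2) Corollary, p. 309.
* [KellockDokchitser2023] L. C. Kellock, V. Dokchitser, *Root numbers and parity phenomena*, Bull.
  Lond. Math. Soc. 55 (2023), §3.16, Prop. 3.54 (arXiv:2303.07883, p. 21 of the held text).
* [Darmon2004] H. Darmon, *Rational points on modular elliptic curves*, CBMS 101 (2004), §3.9,
  proof of Thm. 3.22 (odd order of `L(E/K, s)`).
-/

noncomputable section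

open scoped Classical

open WeierstrassCurve Literature.NumberTheory.EllipticCurves.ModularForms

universe u

namespace Literature.NumberTheory.EllipticCurves

/-! ### Gross–Zagier V.(1.2) for `E/ℚ` and `χ = 1`: `ord_{s=1} L(E/K, s) = 1` or `≥ 3` -/

section GrossZagierV12

variable (W : WeierstrassCurve ℚ) (K : Type) [Field K] [NumberField K]

/-- **Gross–Zagier 1986, V.(1.2), case `E/ℚ`, `χ = 1`** (p. 309: "either … a simple zero at
`s = 1` or else … a zero of order `≥ 3`. Indeed, each … has an odd order zero at `s = 1` by the
functional equation"): if `ord_{s=1} L(E/K, s)` is odd for every elliptic `E/ℚ` and every imaginary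
quadratic `K` satisfying the Heegner hypothesis for `N_E` (the tree's named fact
`odd_analyticRankEK_of_satisfiesHeegnerHypothesis`, hypothesis `h`), then for such `(E, K)`:
`analyticRankEK W K = 1 ∨ 3 ≤ analyticRankEK W K`. [cite: GrossZagierInvent1986, V.(1.2) Corollary (p. 309)] -/
theorem analyticRankEK_eq_one_or_three_le_of_odd (h : odd_analyticRankEK_of_satisfiesHeegnerHypothesis)
    [W.IsElliptic] (hK : IsImaginaryQuadratic K)
    (hH : SatisfiesHeegnerHypothesis (W.conductorNorm ℤ) K) :
    analyticRankEK W K = 1 ∨ 3 ≤ analyticRankEK W K := by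
  obtain ⟨k, hk⟩ := h W K hK hH
  omega

/-- **Gross–Zagier 1986, V.(1.2), case `E/ℚ`, `χ = 1`, from the Modularity Theorem alone**: for
every elliptic `E/ℚ` (model `W`) and every imaginary quadratic `K` in which all primes dividing
`N_E` split, `ord_{s=1} L(E, s) L(E^{(d_K)}, s) = 1` or `≥ 3` — the odd order of vanishing being the
tree's theorem `odd_analyticRankEK_of_satisfiesHeegnerHypothesis_of_exists_isNewformOf` (Kronecker
twist of the newform of `E` and Atkin–Lehner signs; Gross 1984, §5; Darmon 2004, §3.9) under
`exists_isNewformOf` (Breuil–Conrad–Diamond–Taylor 2001, Thm. A; hypothesis `hmod`).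
[cite: GrossZagierInvent1986, V.(1.2) Corollary (p. 309)] -/
theorem analyticRankEK_eq_one_or_three_le_of_exists_isNewformOf (hmod : exists_isNewformOf)
    [W.IsElliptic] (hK : IsImaginaryQuadratic K)
    (hH : SatisfiesHeegnerHypothesis (W.conductorNorm ℤ) K) :
    analyticRankEK W K = 1 ∨ 3 ≤ analyticRankEK W K :=
  analyticRankEK_eq_one_or_three_le_of_odd W K
    (odd_analyticRankEK_of_satisfiesHeegnerHypothesis_of_exists_isNewformOf hmod) hK hH

/-- **Gross–Zagier 1986, V.(1.2), case `E/ℚ`, `χ = 1`, for `r_an(E/K) = ord_{s=1} L(E/K, s)`** in the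
tree's base-change carrier `W.analyticRankOver K` (the analytic rank of `W.baseChange K`): under
the Modularity Theorem (`hmod`) and the compatibility fact
`analyticRankOver_eq_analyticRankEK` (`r_an(E/K) = ord_{s=1} L(E, s) L(E^{(d_K)}, s)`, Darmon 2004,
(3.12); hypothesis `hcomp`), for every elliptic `E/ℚ` and imaginary quadratic `K` satisfying the
Heegner hypothesis for `N_E`: `r_an(E/K) = 1 ∨ 3 ≤ r_an(E/K)`.
[cite: GrossZagierInvent1986, V.(1.2) Corollary (p. 309)] -/
theorem analyticRankOver_eq_one_or_three_le_of_exists_isNewformOf (hmod : exists_isNewformOf)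
    (hcomp : analyticRankOver_eq_analyticRankEK.{0}) [W.IsElliptic] (hK : IsImaginaryQuadratic K)
    (hH : SatisfiesHeegnerHypothesis (W.conductorNorm ℤ) K) :
    W.analyticRankOver K = 1 ∨ 3 ≤ W.analyticRankOver K := by
  rw [hcomp W K hK]
  exact analyticRankEK_eq_one_or_three_le_of_exists_isNewformOf W K hmod hK hH

end GrossZagierV12

/-! ### Kellock–Dokchitser 2023, Prop. 3.54 (ii): `ord_{s=1} L(E/F, s) ≥ n` for dihedral `F ⊇ K` -/

/-- **Kellock–Dokchitser 2023, Prop. 3.54 (ii)** (§3.16 "Heegner hypothesis"), as printed: "Let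
`E/ℚ` be an elliptic curve and let `K` be a quadratic extension of `ℚ` that satisfies the Heegner
hypothesis [`K` imaginary and all primes of bad reduction of `E/ℚ` split in `K`]. Let `F` be a
`C_n`-extension of `K` so that `Gal(F/ℚ) = D_{2n}`, the dihedral group with `2n` elements. Assume
that `(N_E, Δ_F) = 1`. Then … (ii) The order of vanishing of the `L`-function of `E/F` satisfies
`ord_{s=1} L(E/F, s) ≥ n`." In the tree's carriers: `W` elliptic with conductor
`N_E = W.conductorNorm ℤ`; `K` with `IsImaginaryQuadratic K` and
`SatisfiesHeegnerHypothesis N_E K` (the primes of bad reduction are the primes dividing `N_E`);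
`F ⊇ K` a number field, Galois over `ℚ` with `Gal(F/ℚ) ≃* DihedralGroup n` (Mathlib, of order
`2n`), Galois and cyclic of degree `n` over `K`; `Δ_F = NumberField.discr F`; and
`ord_{s=1} L(E/F, s) = W.analyticRankOver F`, the analytic rank of the base change `W.baseChange F`
(order at `1` of the entire continuation of Mathlib's `L(E/F, s)`; for `n ≥ 1` the inequality
entails that this continuation exists, as it does in print: `L(E/F, s) = ∏_χ L(E/K, χ, s)` with
entire factors). Printed proof: inductivity `L(E/F, s) = ∏_χ L(E/K, χ, s)` over the `n` characters
of `Gal(F/K)`, each factor having root number `-1` (Heegner hypothesis) hence odd order; the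
analytic skeleton is `Literature.NumberTheory.LFunctions.CentralOrder.sum_le_analyticOrderAt_finset_prod_pow_of_sign`.
Named fact (D-0014), not proved here: the tree has no twisted `L`-series `L(E/K, χ, s)`.
[cite: KellockDokchitser2023, §3.16 Prop. 3.54 (ii)] -/
def KellockDokchitser2023_prop_3_54_ii : Prop :=
  ∀ (W : WeierstrassCurve ℚ) [W.IsElliptic] (K : Type u) [Field K] [NumberField K]
    (F : Type u) [Field F] [NumberField F] [Algebra K F] (n : ℕ) [NeZero n],
    IsImaginaryQuadratic K → SatisfiesHeegnerHypothesis (W.conductorNorm ℤ) K →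
    IsGalois ℚ F → Nonempty ((F ≃ₐ[ℚ] F) ≃* DihedralGroup n) →
    IsGalois K F → IsCyclic (F ≃ₐ[K] F) → Module.finrank K F = n →
    Nat.Coprime (W.conductorNorm ℤ) (NumberField.discr F).natAbs →
      n ≤ W.analyticRankOver F

end Literature.NumberTheory.EllipticCurves
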